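/-
Copyright (c) 2026 the pub-hodgecm-mathlib formalisation cell (harness21).  Prover seat hodgecm-mathlib-K2Liu-p13 (g3), Track B «K2-LIT»,
#184♮ = hLiu418 = `stmt-HodgeConjecture-24832`; ROAD Φ (RULING «M-156n»), consumer sheet fa2b1e3a29709f09 row G6-fin — the assembled, UNCONDITIONAL
global intertwining law (★ `K2LiuIntertwiningDeltaEquivariance` with both named binders discharged: (MOD) ★∕📤 `K2LiuUnipDeltaConjugationModulusAdelic`,
(WCHAR) ★ `K2LiuSiegelWeylCharacterLaw`).  THEOREMS ONLY (no `def`, no `instance`, no named-fact hypothesis, no `sorry`).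
-/
import Summits.HodgeConjecture.HodgeConjecture.Theorems.K2LiuUnipDeltaConjugationModulusAdelic   -- (MOD) `hmod_holds`
import Summits.HodgeConjecture.HodgeConjecture.Theorems.K2LiuIntertwiningDeltaEquivariance        -- ★ the conditional law
import Summits.HodgeConjecture.HodgeConjecture.Theorems.K2LiuSiegelWeylCharacterLaw               -- ★ (WCHAR)
import HarnessLib

/-!
# Crux `HLiu418`, ROAD Φ, organ Φ8 (sheet row G6-fin): THE GLOBAL INTERTWINING LAW `M(s) : I(s, χ) → I(−s, χ′)`, UNCONDITIONAL

Cell `hodgecm-mathlib`, crux item hLiu418 = `stmt-HodgeConjecture-24832` (helper lane, count-neutral).  GENERIC `n`, doubled frame `H(𝔸) = HA L e dV hdV dW hdW`.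
★ `K2LiuIntertwiningDeltaEquivariance.isSiegelDeltaSection_intertwiningDelta` proved: for a `(P_Δ(𝔸), χ, s)`-section `f`, the big-cell intertwining integral
`M(s)f = intertwiningDelta νN f` is a `(P_Δ(𝔸), χ′, −s)`-section, GIVEN (MOD) the modulus `hmod` of `Ad(P_Δ(𝔸))` on `(N_Δ(𝔸), νN)` and (WCHAR) the Weyl-conjugated
character law `hwchar` along a Levi homomorphism `Λ` by value.  Both are now theorems — (MOD) = `K2LiuUnipDeltaConjugationModulusAdelic.hmod_holds` (every Haar
`νN`), (WCHAR) = ★ `K2LiuSiegelWeylCharacterLaw.siegelDeltaCharacter_weylDelta_conj_levi` (for `χ′ = (χ ∘ c)⁻¹` on ideles) — and the Levi homomorphism by value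
exists (★ `exists_siegelLeviChart`).  This file assembles them:
* `exists_leviHom_blk_eq` — a Levi homomorphism `Λ : GL_n(𝔸_L) →* H(𝔸)` BY VALUE exists (from the chart);
* **`isSiegelDeltaSection_intertwiningDelta_of_conj`** — `M(s) : I(s, χ) → I(−s, χ′)` for EVERY Haar measure `νN` on `N_Δ(𝔸)`, every `s`, with
  `χ′ u = (χ (c u))⁻¹`, NO other hypothesis;
* **`intertwiningDelta_family_equivariant_of_conj`** — the family form = the binder `heqv` of ★ `K2LiuBigCellGrowthOfEquivariance.growth_of_equivariance`
  with `ω s p = χ′_det(p) · modDelta(p)^{n − 2s}`, unconditional.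
Sources: [Garrett2018, §3.10–§3.12]; [MoeglinWaldspurger1995, II.1.6]; [HarrisKudlaSweet1996, §1 (1.11)–(1.15), §6]; [KudlaSweet1997, §1]; [Shahidi2010, §4.1].
HONEST LABEL.  Helper lemmas, count-neutral; `HC_CM` is proved only modulo the 7 printed citations (2 remaining named inputs:
hLiu418 = `stmt-HodgeConjecture-24832`, h413 = `stmt-HodgeConjecture-24833`) until rung 0 closes.
-/

set_option autoImplicit false
set_option linter.dupNamespace false -- the mandated namespace repeats `HodgeConjecture.HodgeConjecture`

noncomputable section

open scoped Matrix NNReal ENNReal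
open NumberField IsDedekindDomain MeasureTheory MeasureTheory.Measure

namespace Summit.HodgeConjecture.HodgeConjecture.Cruxes.HLiu418.K2LiuIntertwiningDeltaUnconditional

open Literature.NumberTheory.GelbartRogawski1991.AdaptedBlocks
open Literature.NumberTheory.Automorphic Literature.NumberTheory.Automorphic.UnitaryGroup
open Literature.NumberTheory.GelbartRogawski1991 Literature.NumberTheory.GelbartRogawski1991.GRConstruction
open Literature.NumberTheory.K2Lit.SiegelDoubled Literature.NumberTheory.GaloisRepresentations
open UnitaryDualPair
open Summit.HodgeConjecture.HodgeConjecture.Cruxes.HLiu418.K2LiuSiegelDoubledLeviChart (exists_siegelLeviChart)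
open Summit.HodgeConjecture.HodgeConjecture.Cruxes.HLiu418.K2LiuSiegelLeviConjUnipDeltaChar (conj_mem_unipDelta)
open Summit.HodgeConjecture.HodgeConjecture.Cruxes.HLiu418.K2LiuIntertwiningDeltaEquivariance
open Summit.HodgeConjecture.HodgeConjecture.Cruxes.HLiu418.K2LiuSiegelWeylCharacterLaw
open Summit.HodgeConjecture.HodgeConjecture.Cruxes.HLiu418.K2LiuUnipDeltaConjugationModulusAdelic (hmod_holds)

variable (L : Type) [Field L] [NumberField L] [IsCMField L]
variable {N M n : ℕ} (e : Fin N × Fin M ≃ Fin n)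
  (dV : Fin N → L) (hdV : ∀ i, IsCMField.complexConj L (dV i) = dV i)
  (dW : Fin M → L) (hdW : ∀ i, IsCMField.complexConj L (dW i) = dW i)

/-! ## §1 A Levi homomorphism by value -/

/-- a Levi homomorphism `Λ : GL_n(𝔸_L) →* H(𝔸)` BY VALUE (`blk (Λ g) = R·diag(g, g♯)·R⁻¹`, `g♯ = T⁻¹ (c g)⁻ᵀ T`) exists — read off the Siegel–Levi chart
★ `exists_siegelLeviChart`. [cite: HarrisKudlaSweet1996, §1 (1.11)] [cite: MoeglinWaldspurger1995, II.1.5] -/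
theorem exists_leviHom_blk_eq (hdV0 : ∀ i, dV i ≠ 0) (hdW0 : ∀ i, dW i ≠ 0) :
    ∃ Λ : GL (Fin n) (AdeleRing (𝓞 L) L) →* HA L e dV hdV dW hdW, ∀ g : GL (Fin n) (AdeleRing (𝓞 L) L), blk L e dV hdV dW hdW (Λ g) =
      cayR (AdeleRing (𝓞 L) L) (Fin n) * Matrix.fromBlocks (g : Matrix (Fin n) (Fin n) (AdeleRing (𝓞 L) L)) 0 0
        (((gramR L e dV hdV dW hdW).map ((algebraMap L (AdeleRing (𝓞 L) L)).comp (algebraMap (Fp L) L)))⁻¹ *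
          (((g⁻¹ : GL (Fin n) (AdeleRing (𝓞 L) L)) : Matrix (Fin n) (Fin n) (AdeleRing (𝓞 L) L)).map
            (conjAdele (Fp L) L (IsCMField.complexConj L)))ᵀ *
          (gramR L e dV hdV dW hdW).map ((algebraMap L (AdeleRing (𝓞 L) L)).comp (algebraMap (Fp L) L))) *
        cayRinv (AdeleRing (𝓞 L) L) (Fin n) := by
  obtain ⟨Mg, Ng, eMN, φ, hS, hNg, hNgD, hφ⟩ := exists_siegelLeviChart L e dV hdV dW hdW hdV0 hdW0
  exact ⟨((siegelDelta L e dV hdV dW hdW).subtype.comp Mg.subtype).comp φ.toMonoidHom, fun g => hφ g⟩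

/-! ## §2 The unconditional intertwining law -/

/-- **THE GLOBAL INTERTWINING LAW, UNCONDITIONAL.**  For every Haar measure `νN` on `N_Δ(𝔸)`, every Hecke character `χ` with `χ′ u = (χ (c u))⁻¹`, every `s`
and every `(P_Δ(𝔸), χ, s)`-section `f`:  `M(s)f = intertwiningDelta νN f` is a `(P_Δ(𝔸), χ′, −s)`-section — ★ `isSiegelDeltaSection_intertwiningDelta` fed
with (MOD) `hmod_holds` and (WCHAR) ★ `siegelDeltaCharacter_weylDelta_conj_levi` along the Levi homomorphism of `exists_leviHom_blk_eq`.
[cite: Garrett2018, §3.10] [cite: MoeglinWaldspurger1995, II.1.6] [cite: HarrisKudlaSweet1996, §6] [cite: KudlaSweet1997, §1] -/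
theorem isSiegelDeltaSection_intertwiningDelta_of_conj (hdV0 : ∀ i, dV i ≠ 0) (hdW0 : ∀ i, dW i ≠ 0)
    [MeasurableSpace (unipDelta L e dV hdV dW hdW)] [BorelSpace (unipDelta L e dV hdV dW hdW)]
    (νN : Measure (unipDelta L e dV hdV dW hdW)) [νN.IsHaarMeasure] (χ χ' : HeckeCharacter L)
    (hχ' : ∀ u : (AdeleRing (𝓞 L) L)ˣ,
      χ' u = (χ (Units.map (conjAdele (Fp L) L (IsCMField.complexConj L) : AdeleRing (𝓞 L) L →* AdeleRing (𝓞 L) L) u))⁻¹)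
    (s : ℂ) {f : HA L e dV hdV dW hdW → ℂ} (hf : IsSiegelDeltaSection L e dV hdV dW hdW χ s f) :
    IsSiegelDeltaSection L e dV hdV dW hdW χ' (-s) (intertwiningDelta L e dV hdV dW hdW νN f) := by
  obtain ⟨Λ, hΛ⟩ := exists_leviHom_blk_eq L e dV hdV dW hdW hdV0 hdW0
  exact isSiegelDeltaSection_intertwiningDelta L e dV hdV dW hdW Λ hΛ hdV0 hdW0 νN (hmod_holds L e dV hdV dW hdW hdV0 hdW0 νN) χ χ' s
    (siegelDeltaCharacter_weylDelta_conj_levi L e dV hdV dW hdW Λ hΛ hdV0 hdW0 χ χ' hχ' s) hf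

/-- **the family form, unconditional** — the binder `heqv` of ★ `K2LiuBigCellGrowthOfEquivariance.growth_of_equivariance` with
`ω s p = χ′_det(p) · modDelta(p)^{n − 2s}` on `{c < re}` (any `c`), for a family `f s` of `(P_Δ(𝔸), χ, s)`-sections and any normalising scalar `a s`.
[cite: Garrett2018, §3.10] [cite: HarrisKudlaSweet1996, §6] [cite: KudlaSweet1997, §1] -/
theorem intertwiningDelta_family_equivariant_of_conj (hdV0 : ∀ i, dV i ≠ 0) (hdW0 : ∀ i, dW i ≠ 0)
    [MeasurableSpace (unipDelta L e dV hdV dW hdW)] [BorelSpace (unipDelta L e dV hdV dW hdW)]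
    (νN : Measure (unipDelta L e dV hdV dW hdW)) [νN.IsHaarMeasure] (χ χ' : HeckeCharacter L)
    (hχ' : ∀ u : (AdeleRing (𝓞 L) L)ˣ,
      χ' u = (χ (Units.map (conjAdele (Fp L) L (IsCMField.complexConj L) : AdeleRing (𝓞 L) L →* AdeleRing (𝓞 L) L) u))⁻¹)
    (c : ℝ) (f : ℂ → HA L e dV hdV dW hdW → ℂ) (hf : ∀ s : ℂ, IsSiegelDeltaSection L e dV hdV dW hdW χ s (f s)) (a : ℂ → ℂ) :
    ∀ s : ℂ, c < s.re → ∀ p ∈ {p : HA L e dV hdV dW hdW | IsSiegelDelta L e dV hdV dW hdW p}, ∀ h : HA L e dV hdV dW hdW,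
      a s * intertwiningDelta L e dV hdV dW hdW νN (f s) (p * h) =
        (((chiDet L e dV hdV dW hdW χ' p : ℂˣ) : ℂ) * ((modDelta L e dV hdV dW hdW p : ℝ) : ℂ) ^ (((n : ℝ) : ℂ) - 2 * s)) *
          (a s * intertwiningDelta L e dV hdV dW hdW νN (f s) h) := by
  obtain ⟨Λ, hΛ⟩ := exists_leviHom_blk_eq L e dV hdV dW hdW hdV0 hdW0
  exact intertwiningDelta_family_equivariant L e dV hdV dW hdW Λ hΛ hdV0 hdW0 νN (hmod_holds L e dV hdV dW hdW hdV0 hdW0 νN) χ χ'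
    (siegelDeltaCharacter_weylDelta_conj_levi_family L e dV hdV dW hdW Λ hdV0 hdW0 χ χ' hΛ hχ' c) f hf a

/-- the same equivariance stated for ALL `s` (no half-plane restriction), pointwise. [cite: Garrett2018, §3.10] -/
theorem intertwiningDelta_siegel_mul_apply (hdV0 : ∀ i, dV i ≠ 0) (hdW0 : ∀ i, dW i ≠ 0)
    [MeasurableSpace (unipDelta L e dV hdV dW hdW)] [BorelSpace (unipDelta L e dV hdV dW hdW)]
    (νN : Measure (unipDelta L e dV hdV dW hdW)) [νN.IsHaarMeasure] (χ χ' : HeckeCharacter L)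
    (hχ' : ∀ u : (AdeleRing (𝓞 L) L)ˣ,
      χ' u = (χ (Units.map (conjAdele (Fp L) L (IsCMField.complexConj L) : AdeleRing (𝓞 L) L →* AdeleRing (𝓞 L) L) u))⁻¹)
    (s : ℂ) {f : HA L e dV hdV dW hdW → ℂ} (hf : IsSiegelDeltaSection L e dV hdV dW hdW χ s f)
    {p : HA L e dV hdV dW hdW} (hp : IsSiegelDelta L e dV hdV dW hdW p) (h : HA L e dV hdV dW hdW) :
    intertwiningDelta L e dV hdV dW hdW νN f (p * h) =
      siegelDeltaCharacter L e dV hdV dW hdW χ' (-s) p * intertwiningDelta L e dV hdV dW hdW νN f h :=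
  isSiegelDeltaSection_intertwiningDelta_of_conj L e dV hdV dW hdW hdV0 hdW0 νN χ χ' hχ' s hf p hp h

/-- the family packaging: if `s ↦ f s` is a `χ`-section family then `s ↦ M(−s) f_{−s} = intertwiningDelta νN (f (−s))` is a `χ′`-section family.
[cite: Garrett2018, §3.10] [cite: KudlaSweet1997, §1] -/
theorem isSiegelDeltaSectionFamily_intertwiningDelta_of_conj (hdV0 : ∀ i, dV i ≠ 0) (hdW0 : ∀ i, dW i ≠ 0)
    [MeasurableSpace (unipDelta L e dV hdV dW hdW)] [BorelSpace (unipDelta L e dV hdV dW hdW)]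
    (νN : Measure (unipDelta L e dV hdV dW hdW)) [νN.IsHaarMeasure] (χ χ' : HeckeCharacter L)
    (hχ' : ∀ u : (AdeleRing (𝓞 L) L)ˣ,
      χ' u = (χ (Units.map (conjAdele (Fp L) L (IsCMField.complexConj L) : AdeleRing (𝓞 L) L →* AdeleRing (𝓞 L) L) u))⁻¹)
    {f : ℂ → HA L e dV hdV dW hdW → ℂ} (hf : IsSiegelDeltaSectionFamily L e dV hdV dW hdW χ f) :
    IsSiegelDeltaSectionFamily L e dV hdV dW hdW χ' (fun s => intertwiningDelta L e dV hdV dW hdW νN (f (-s))) := by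
  intro s
  have h := isSiegelDeltaSection_intertwiningDelta_of_conj L e dV hdV dW hdW hdV0 hdW0 νN χ χ' hχ' (-s) (hf (-s))
  rwa [neg_neg] at h

end Summit.HodgeConjecture.HodgeConjecture.Cruxes.HLiu418.K2LiuIntertwiningDeltaUnconditional

end
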